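/-
Copyright (c) 2026 the pub-hodgecm-mathlib formalisation cell (harness21).  Prover seat hodgecm-mathlib-A-p16 (g33): road «S3-ram» (LEAD F0P3a-plan (g13); owner lineage
F0P3a-p06), the (Cnt2′) BLOCK-LAW skeleton (keeper F0P3a-p06 (g16) v2.2–v2.4, chair F0P3a-p07 (g15) RULINGS (13)(6), (17), (18)): composition pen `stub_Zaniso`, FILE Z9 —
THE REGIME A-ODD ∕ C ANISOTROPIC CELL, ROW `0`, CLOSED; 2026-09-02.
-/
import Literature.NumberTheory.Rogawski1990.DepthZeroKappaTransferTypeTwoRamifiedAnisotropicRootCensusParams   -- p849702 (this seat): «ANISO ROOT CENSUS IN PARAMS CURRENCY»; brings ★ p849189 (odd totals), the CM dictionary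
import Literature.NumberTheory.Rogawski1990.DepthZeroKappaTransferTypeTwoRamifiedBlockRootCensusAffine       -- ★ p849444 (F0P3a-p02 (g18)): `TypeTwoBlockRoot.natCard_params_blockFrame_null_eq'`, `two_mul_natCard_params_blockFrame_quadraticChar_eq'`
import HarnessLib

/-!
# The ramified `κ`-orbital integral, type (2): THE REGIME A-ODD ∕ C ANISOTROPIC CELL OF THE BLOCK-LAW SKELETON, ROW `0` — `#B = 1 + NE·S(E) + P·S(P)` keyed on `(β, θ)_v`
# (Rogawski 1990 §4.9; Kottwitz 1986 §3; Bruhat–Tits 1972 §10)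

Topic `NumberTheory/Rogawski1990`; namespace `Literature.NumberTheory.Rogawski1990.BlockLawAniso`.  THEOREMS ONLY (no definition, no instance, no notation, no named fact,
no `sorry`); kernel lane `--supports stmt-HodgeConjecture-24833`.  Cell `pub/hodgecm-mathlib` (D-0151), crux H413; road «S3-ram» (Literature seeding, count-neutral); the
(Cnt2′) BLOCK-LAW skeleton of keeper F0P3a-p06 (g16), v2.2–v2.4 (`F0/P3a/F0P3a-p06/g16/blocklaw/v2_4/BlockLawZero.skeleton.v2_4.F0P3ap06g16.lean` :552):
**`zaniso_zero_odd_A_ram` = the keeper's cell `stub_Zaniso_zero_odd_A` VERBATIM** (the three idle frame binders `_`-prefixed), CLOSED: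
`∀ mA, n = mA + 1 → m = 2n + 1 → ∃ NE P, #B = 1 + NE·(Σ_{i<mA+1} q^{2i} + Σ_{i<mA} q^{2mA+1+i}) + P·Σ_{i<mA} q^{2i} ∧ ((β,θ)_v = 1 → NE = 0 ∧ P = (q+1)q) ∧ ((β,θ)_v = −1 → NE = 2q ∧
P = (q−1)q)` — the TIE `m = N` (regimes A-odd ∕ C), where the anisotropic root carries `E`-chains iff `det T̄` is a non-square.

THE COMPOSITION ([Rogawski1990] §4.9 Prop. 4.9.1 (b), Lemma 4.9.3; [Kottwitz1986] §3).  Row `0` of the anisotropic literal at the centred `γ′ = P₁·ι(s·γ₁, 1)·P₁⁻¹` is ★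
`anisotropicTotal_zero_ram_of_census_odd` (this seat, p849189) in the root's three slices `(NE, NP, NM)`; «ANISO ROOT CENSUS IN PARAMS CURRENCY» (this seat, p849702 =
★ p849483 ∘ ★ p849383 ∘ ★ p849644 dressed) writes them as `q·(ν₀, ν₊, ν₋)`, residual-conic fibres of `Q_{Ȳ₀}` with the residual frame `(Ā, δ, B = ι(T̄, 0))`; the FINITE
census ★ `TypeTwoBlockRoot.natCard_params_blockFrame_null_eq'` ∕ `two_mul_natCard_params_blockFrame_quadraticChar_eq'` (F0P3a-p02 (g18), p849444) at `(i₀, j, l) = (1, 0, 2)`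
gives `ν₀ = 1 + χ(δ₀δ₂(B₀₂B₂₀ − B₀₀B₂₂)) = 1 − χ(det T̄)` (`χ(−δ₀δ₂) = −1`) and `ν₊ + ν₋ = q + χ(det T̄)` (the elliptic `J`-sums cancel in the sum of the two classes);
the sign clause `(β,θ)_v = 1 ⟺ χ(det T̄) = 1` (p849702, from ★ chair p849319) and `det T̄ ≠ 0` finish: `(NE, P) = (0, (q+1)q)` or `(2q, (q−1)q)`.
HONEST LABEL: HC_CM is proved only modulo the 2 remaining named inputs (hLiu418 24832, h413 24833) until rung 0 closes; nothing printed is asserted here (composition of ★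
theorems); «S3-ram» has no books consequence.

## References
* [Rogawski1990] J. D. Rogawski, *Automorphic Representations of Unitary Groups in Three Variables*, Ann. of Math. Stud. 123 (1990), §4.9 Prop. 4.9.1 (b) p. 55, Lemma 4.9.3 p. 56.
* [Kottwitz1986] R. E. Kottwitz, *Base change for unit elements of Hecke algebras*, Compositio Math. 60 (1986), §3.
* [BruhatTits1972] F. Bruhat, J. Tits, *Groupes réductifs sur un corps local I*, Publ. Math. IHÉS 41 (1972), §10.
-/

set_option autoImplicit false

noncomputable section

open NumberField IsDedekindDomain Matrix Polynomial ValuativeRel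
open Literature.NumberTheory.Automorphic Literature.NumberTheory.Automorphic.UnitaryGroup
open Literature.NumberTheory.Automorphic.UnitaryLatticeTree Literature.NumberTheory.Automorphic.HermitianLattice
open Literature.NumberTheory.GaloisRepresentations Literature.NumberTheory.QuadraticForms
open Literature.NumberTheory.Rogawski1990 Literature.NumberTheory.Rogawski1990.TypeOneRamifiedJunction Literature.NumberTheory.Rogawski1990.TypeTwoBlockRoot
open scoped Matrix MatrixGroups ValuativeRel WithZero

namespace Literature.NumberTheory.Rogawski1990.BlockLawAniso

/-- The cell's closing arithmetic (private plumbing): from `ν₀ = 1 − χ`, `2ν± = q + χ ± key·J` and `χ = ±1` to the two value clauses. [folklore] -/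
private theorem zaniso_zero_odd_A_arith (q ν₀ νP νM : ℕ) (χ key J : ℤ) (absN : ℂ) (hq : (q : ℂ) = absN)
    (h0 : (ν₀ : ℤ) = 1 + -χ) (hP : 2 * (νP : ℤ) = q - -χ + 1 * key * J) (hM : 2 * (νM : ℤ) = q - -χ + -1 * key * J) :
    (χ = 1 → ((q * ν₀ : ℕ) : ℂ) = 0 ∧ ((q * νP + q * νM : ℕ) : ℂ) = (absN + 1) * absN) ∧
    (χ = -1 → ((q * ν₀ : ℕ) : ℂ) = 2 * absN ∧ ((q * νP + q * νM : ℕ) : ℂ) = (absN - 1) * absN) := by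
  have hs : ((νP : ℤ) + νM) = q + χ := by linarith
  constructor
  · intro hχ
    subst hχ
    have e0 : ((q * ν₀ : ℕ) : ℤ) = 0 := by push_cast; rw [h0]; ring
    have e1 : ((q * νP + q * νM : ℕ) : ℤ) = (q + 1) * q := by push_cast; rw [← mul_add, hs]; ring
    refine ⟨?_, ?_⟩
    · have h := congrArg (Int.cast : ℤ → ℂ) e0
      push_cast at h ⊢; exact h
    · have h := congrArg (Int.cast : ℤ → ℂ) e1
      push_cast at h ⊢; rw [← hq]; exact h
  · intro hχ
    subst hχ
    have e0 : ((q * ν₀ : ℕ) : ℤ) = 2 * q := by push_cast; rw [h0]; ring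
    have e1 : ((q * νP + q * νM : ℕ) : ℤ) = (q - 1) * q := by push_cast; rw [← mul_add, hs]; ring
    refine ⟨?_, ?_⟩
    · have h := congrArg (Int.cast : ℤ → ℂ) e0
      push_cast at h ⊢; rw [← hq]; exact h
    · have h := congrArg (Int.cast : ℤ → ℂ) e1
      push_cast at h ⊢; rw [← hq]; exact h

set_option maxHeartbeats 3200000 in
-- budget only: the keeper's statement-heavy socket telescope (verbatim) + two statement-heavy ★ heads instantiated; the proof is a composition of ★ heads, no search.
/-- **THE KEEPER'S CELL `stub_Zaniso_zero_odd_A`, CLOSED** (regimes A-odd ∕ C, row `0`, anisotropic literal; see the module docstring).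
[cite: Rogawski1990, §4.9 Prop. 4.9.1 (b) p. 55, Lemma 4.9.3 p. 56] [cite: Kottwitz1986, §3] [cite: BruhatTits1972, §10] -/
theorem zaniso_zero_odd_A_ram
    (L : Type) [Field L] [NumberField L] [IsCMField L] (H' : Matrix (Fin 3) (Fin 3) L)
    {v : HeightOneSpectrum (𝓞 ↥(maximalRealSubfield L))}
    (_hH' : (H'.map (cmConjRingHom L)).transpose = H') (w : PlacesOver L v)
    (hw : IsCMField.complexConj L • w.1 = w.1) (he : v.asIdeal.ramificationIdx' w.1.asIdeal ≠ 1)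
    (hH'w : IsUnit (placeForm H' w.1)) (_hH'i : hH'w.unit ∈ glInt 3 (w.1.adicCompletion L))
    (h2 : IsUnit (2 : 𝒪[(w.1.adicCompletion L)]))
    (ϖ : w.1.adicCompletion L) (hϖ : Valued.v ϖ = WithZero.exp (-1 : ℤ)) (hσϖ : galAdicCompletionMap (L := L) (IsCMField.complexConj L) hw ϖ = -ϖ)
    (A : GL (Fin 3) (w.1.adicCompletion L)) (_hA : A ∈ glInt 3 (w.1.adicCompletion L))
    (_hframe : placeForm H' w.1 = (-(placeForm H' w.1).det) • formCongr (galAdicCompletionMap (L := L) (IsCMField.complexConj L) hw) A ((StdForm.antidiagonal 3).over (w.1.adicCompletion L))) :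

    ∀ ⦃γH : ((cmDatum L 2 (Matrix.of fun i j : Fin 2 => if i.val + j.val + 1 = 2 then (1 : L) else 0)).Local v × (cmDatum L 1 (Matrix.of fun i j : Fin 1 => if i.val + j.val + 1 = 1 then (1 : L) else 0)).Local v)⦄,
      (∀ i j : Fin 2, Valued.v (((((γH.1.val : GL (Fin 2) (UnitaryGroup.LocalRing L v)).val.map (Pi.evalRingHom (fun w' : PlacesOver L v => w'.1.adicCompletion L) w))) - 1) i j) ≤ Valued.v (ϖ ^ 2)) → Valued.v (finGammaTwo L v γH w - 1) ≤ Valued.v (ϖ ^ 2) → IsLocalGRegular L v γH →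
      (¬ ∃ x : (w.1.adicCompletion L), ((((γH.1.val : GL (Fin 2) (UnitaryGroup.LocalRing L v)).val.map (Pi.evalRingHom (fun w' : PlacesOver L v => w'.1.adicCompletion L) w))).charpoly).IsRoot x) → ∀ ⦃n : ℕ⦄,
      Valued.v ((((γH.1.val : GL (Fin 2) (UnitaryGroup.LocalRing L v)).val.map (Pi.evalRingHom (fun w' : PlacesOver L v => w'.1.adicCompletion L) w))).trace ^ 2 - 4 * (((γH.1.val : GL (Fin 2) (UnitaryGroup.LocalRing L v)).val.map (Pi.evalRingHom (fun w' : PlacesOver L v => w'.1.adicCompletion L) w))).det) = WithZero.exp (-((2 * (2 * n + 1) : ℕ) : ℤ)) → 1 ≤ n →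
      ∀ (m : ℕ), Valued.v (((finCharpolyTwo L v γH).eval (finGammaTwo L v γH)) w) =
          Valued.v ((toPlace v w (HeckeCharacter.uniformizer ↥(maximalRealSubfield L) v : v.adicCompletion ↥(maximalRealSubfield L))) ^ m) →
        ∀ β : (v.adicCompletion ↥(maximalRealSubfield L))ˣ, toPlace v w (β : v.adicCompletion ↥(maximalRealSubfield L)) =
          -(((finCharpolyTwo L v γH).eval (finGammaTwo L v γH)) w *
              (finGammaTwo L v γH w ^ 2 +
                ((γH.1.val.val : Matrix (Fin 2) (Fin 2) (LocalRing L v)).map (Pi.evalRingHom (fun w' : PlacesOver L v => w'.1.adicCompletion L) w)).det)) /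
            (2 * finGammaTwo L v γH w ^ 2 *
              ((γH.1.val.val : Matrix (Fin 2) (Fin 2) (LocalRing L v)).map (Pi.evalRingHom (fun w' : PlacesOver L v => w'.1.adicCompletion L) w)).det) →
        ∀ (P₁ : GL (Fin 3) (w.1.adicCompletion L)) (d : Fin 2 → (w.1.adicCompletion L)) (η : (w.1.adicCompletion L)) (γ₁ : GL (Fin 2) (w.1.adicCompletion L)),
        P₁ ∈ glInt 3 (w.1.adicCompletion L) →
        formCongr (galAdicCompletionMap (L := L) (IsCMField.complexConj L) hw) P₁ (placeForm (Matrix.of fun i j : Fin 3 => if i.val + j.val + 1 = 3 then (1 : L) else 0) w.1) = !![(Matrix.diagonal d) 0 0, 0, (Matrix.diagonal d) 0 1; 0, η, 0; (Matrix.diagonal d) 1 0, 0, (Matrix.diagonal d) 1 1] →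
        (∀ i, Valued.v (d i) = 1) → (∀ i, (galAdicCompletionMap (L := L) (IsCMField.complexConj L) hw) (d i) = d i) →
        (∀ z : (w.1.adicCompletion L), Valued.v z ≤ 1 → Valued.v (d 0 + d 1 * ((galAdicCompletionMap (L := L) (IsCMField.complexConj L) hw) z * z)) = 1) →
        (∀ z : (w.1.adicCompletion L), Valued.v z ≤ 1 → Valued.v (d 0 * ((galAdicCompletionMap (L := L) (IsCMField.complexConj L) hw) z * z) + d 1) = 1) →
        (galAdicCompletionMap (L := L) (IsCMField.complexConj L) hw) η = η → Valued.v η = 1 →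
        (∀ i j, Valued.v (((γ₁ : Matrix (Fin 2) (Fin 2) (w.1.adicCompletion L)) - 1) i j) ≤ Valued.v (ϖ ^ 2)) →
        γ₁ ∈ unitaryGroupOfForm (galAdicCompletionMap (L := L) (IsCMField.complexConj L) hw) (Matrix.diagonal d) →
        (γ₁ : Matrix (Fin 2) (Fin 2) (w.1.adicCompletion L)).charpoly = (((γH.1.val : GL (Fin 2) (UnitaryGroup.LocalRing L v)).val.map (Pi.evalRingHom (fun w' : PlacesOver L v => w'.1.adicCompletion L) w))).charpoly →
        Valued.v ((γ₁ : Matrix (Fin 2) (Fin 2) (w.1.adicCompletion L)).trace ^ 2 - 4 * (γ₁ : Matrix (Fin 2) (Fin 2) (w.1.adicCompletion L)).det) = WithZero.exp (-((2 * (2 * n + 1) : ℕ) : ℤ)) →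
        (¬ ∃ x : (w.1.adicCompletion L), ((γ₁ : Matrix (Fin 2) (Fin 2) (w.1.adicCompletion L)).charpoly).IsRoot x) →
        (¬ ∃ t : (w.1.adicCompletion L), t * (galAdicCompletionMap (L := L) (IsCMField.complexConj L) hw) t = η) →
          ∀ (mA : ℕ), n = mA + 1 → m = 2 * n + 1 → ∃ (NE P : ℕ),
          ({M : Submodule (Valued.integer (w.1.adicCompletion L)) (Fin 3 → (w.1.adicCompletion L)) | IsSelfDualLattice (galAdicCompletionMap (L := L) (IsCMField.complexConj L) hw) ϖ (placeForm (Matrix.of fun i j : Fin 3 => if i.val + j.val + 1 = 3 then (1 : L) else 0) w.1) M ∧ mapGL (P₁ * endoGL (γ₁, ((localNonsplitEquiv (IsCMField.complexConj L) (Matrix.of fun i j : Fin 1 => if i.val + j.val + 1 = 1 then (1 : L) else 0) (IsCMField.complexConj_ne_one L) w hw γH.2).val : GL (Fin 1) (w.1.adicCompletion L))) * P₁⁻¹) M = M ∧ M.map ((Matrix.toLin' (((P₁ * endoGL (γ₁, ((localNonsplitEquiv (IsCMField.complexConj L) (Matrix.of fun i j : Fin 1 => if i.val + j.val + 1 = 1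 then (1 : L) else 0) (IsCMField.complexConj_ne_one L) w hw γH.2).val : GL (Fin 1) (w.1.adicCompletion L))) * P₁⁻¹ : GL (Fin 3) (w.1.adicCompletion L)) : Matrix (Fin 3) (Fin 3) (w.1.adicCompletion L)) - 1)).restrictScalars (Valued.integer (w.1.adicCompletion L))) ≤ scaleLattice (ϖ ^ 2) M}.ncard : ℂ) =
            1 + (NE : ℂ) * (∑ i ∈ Finset.range (mA + 1), (Ideal.absNorm v.asIdeal : ℂ) ^ (2 * i) + ∑ i ∈ Finset.range mA, (Ideal.absNorm v.asIdeal : ℂ) ^ (2 * mA + 1 + i)) + (P : ℂ) * ∑ i ∈ Finset.range mA, (Ideal.absNorm v.asIdeal : ℂ) ^ (2 * i) ∧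
          (hilbertSymbol (v.adicCompletion ↥(maximalRealSubfield L)) (β : v.adicCompletion ↥(maximalRealSubfield L)) (algebraMap ↥(maximalRealSubfield L) _ ((cmQuadraticGenerator L : 𝓞 ↥(maximalRealSubfield L)) : ↥(maximalRealSubfield L))) = 1 → (NE : ℂ) = 0 ∧ (P : ℂ) = ((Ideal.absNorm v.asIdeal : ℂ) + 1) * (Ideal.absNorm v.asIdeal : ℂ)) ∧
          (hilbertSymbol (v.adicCompletion ↥(maximalRealSubfield L)) (β : v.adicCompletion ↥(maximalRealSubfield L)) (algebraMap ↥(maximalRealSubfield L) _ ((cmQuadraticGenerator L : 𝓞 ↥(maximalRealSubfield L)) : ↥(maximalRealSubfield L))) = -1 → (NE : ℂ) = 2 * (Ideal.absNorm v.asIdeal : ℂ) ∧ (P : ℂ) = ((Ideal.absNorm v.asIdeal : ℂ) - 1) * (Ideal.absNorm v.asIdeal : ℂ)) := by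
  intro γH hblk hu2 _hreg _hirr n _hdisc hn m hm β hβ P₁ d η γ₁ hP₁ hform hd hσd han₀ han₁ hση hηv hγ2 hγU hχ hdiscγ hirrγ hηN mA hnA hmN
  classical
  have hmA : m = 2 * mA + 3 := by omega
  -- CM dictionary (the little that the two ★ heads do not already take raw)
  have hc1 : IsCMField.complexConj L ≠ 1 := IsCMField.complexConj_ne_one L
  have h2v : Valued.v (2 : (w.1.adicCompletion L)) = 1 := (isUnit_two_integer_iff_valued_eq_one L w.1).1 h2
  have hvσ : ∀ z : (w.1.adicCompletion L), Valued.v ((galAdicCompletionMap (L := L) (IsCMField.complexConj L) hw) z) = Valued.v z := fun z =>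
    valued_galAdicCompletionMap (L := L) (IsCMField.complexConj L) hw z
  haveI : Fintype (Valued.ResidueField (w.1.adicCompletion L)) := Fintype.ofFinite _
  have hqN : (Nat.card (Valued.ResidueField (w.1.adicCompletion L)) : ℂ) = (Ideal.absNorm v.asIdeal : ℂ) := by
    congr 1
    rw [← natCard_residueField_eq_of_compatible, natCard_residueField_eq_of_ramified (IsCMField.complexConj L) v hc1 w hw he, Ideal.absNorm_apply, Submodule.cardQuot_apply]
  have hqF : (Fintype.card (Valued.ResidueField (w.1.adicCompletion L)) : ℤ) = Nat.card (Valued.ResidueField (w.1.adicCompletion L)) := by rw [Nat.card_eq_fintype_card]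
  have hk2 : ringChar (Valued.ResidueField (w.1.adicCompletion L)) ≠ 2 := ringChar_residueField_ne_two h2v
  have hϖ2 : Valued.v (ϖ ^ 2) = Valued.v ϖ ^ 2 := map_pow _ _ _
  -- the middle eigenvalue and the centring unit `s`, the centred literal `γ′`
  have hu00 : (((((localNonsplitEquiv (IsCMField.complexConj L) (Matrix.of fun i j : Fin 1 => if i.val + j.val + 1 = 1 then (1 : L) else 0) (IsCMField.complexConj_ne_one L) w hw γH.2).val : GL (Fin 1) (w.1.adicCompletion L)))) : Matrix (Fin 1) (Fin 1) (w.1.adicCompletion L)) 0 0 = finGammaTwo L v γH w := rfl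
  obtain ⟨s, hs'⟩ := exists_units_mul_oneByOne_eq_one (((localNonsplitEquiv (IsCMField.complexConj L) (Matrix.of fun i j : Fin 1 => if i.val + j.val + 1 = 1 then (1 : L) else 0) (IsCMField.complexConj_ne_one L) w hw γH.2).val : GL (Fin 1) (w.1.adicCompletion L)))
  have hs : (s : (w.1.adicCompletion L)) * finGammaTwo L v γH w = 1 := by rw [← hu00]; exact hs'
  have huu : (galAdicCompletionMap (L := L) (IsCMField.complexConj L) hw) (finGammaTwo L v γH w) * finGammaTwo L v γH w = 1 := by
    have h := congrArg (fun y : LocalRing L v => y w) (conjLocal_finGammaTwo_mul_finGammaTwo L v γH)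
    simpa only [Pi.mul_apply, Pi.one_apply, conjLocal_apply_eq_galAdicCompletionMap L v w hw] using h
  have hsnorm : (galAdicCompletionMap (L := L) (IsCMField.complexConj L) hw) (s : (w.1.adicCompletion L)) * (s : (w.1.adicCompletion L)) = 1 :=
    norm_eq_one_of_mul_eq_one_of_norm_eq_one huu hs
  have hform' : formCongr (galAdicCompletionMap (L := L) (IsCMField.complexConj L) hw) P₁ ((StdForm.antidiagonal 3).over (w.1.adicCompletion L)) =
      !![(Matrix.diagonal d) 0 0, 0, (Matrix.diagonal d) 0 1; 0, η, 0; (Matrix.diagonal d) 1 0, 0, (Matrix.diagonal d) 1 1] := by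
    rw [← placeForm_antidiagOne]; exact hform
  let γ' : unitaryGroupOfForm (galAdicCompletionMap (L := L) (IsCMField.complexConj L) hw) ((StdForm.antidiagonal 3).over (w.1.adicCompletion L)) :=
    ⟨P₁ * endoGL (Matrix.GeneralLinearGroup.scalar (Fin 2) s * γ₁, (1 : GL (Fin 1) (w.1.adicCompletion L))) * P₁⁻¹,
      conj_endoGL_centred_mem_unitaryGroupOfForm_of_formCongr_eq hform' hγU s hsnorm⟩
  have hγ' : (γ' : GL (Fin 3) (w.1.adicCompletion L)) = P₁ * endoGL (Matrix.GeneralLinearGroup.scalar (Fin 2) s * γ₁, (1 : GL (Fin 1) (w.1.adicCompletion L))) * P₁⁻¹ := rfl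
  -- «ANISO ROOT CENSUS IN PARAMS CURRENCY» (p849702) with class constant `1`, and THE ROW-0 TOTAL (★ p849189)
  have h1c : (((1 : Valued.integer (w.1.adicCompletion L)) : Valued.integer (w.1.adicCompletion L)) : (w.1.adicCompletion L)) = 1 := rfl
  obtain ⟨Ab, δ, Y₀, T, B, hY₀, hTe, hG, hδ, hχan, -, -, hY, hB10, hB12, hB01, hB21, hB11, hB00, hB02, hB20, hB22, hadj, hirr, hdet0, hHS, hNE, hNP, hNM⟩ :=
    anisotropicRootCensus_params_odd_ram L w hw he h2 ϖ hϖ hσϖ γH hblk hu2 m hm hn β hβ hmN P₁ d η γ₁ hP₁ hform hd hσd han₀ han₁ hση hηv hγ2 hγU hχ hdiscγ hirrγ hηN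
      s hs γ' hγ' 1 1 h1c (map_one _)
  have htot := anisotropicTotal_zero_ram_of_census_odd L w hw he h2 ϖ hϖ hσϖ γH hu2 m hm P₁ d η γ₁ hP₁ hform hd hσd han₀ han₁ hση hηv hγ2 hγU hχ hirrγ hηN
    mA hmA s hs γ' hγ' 1 (map_one _) _ _ _ hNE hNP hNM
  -- THE FINITE CENSUS (★ p849444) at `(i₀, j, l) = (1, 0, 2)`
  have hnull := natCard_params_blockFrame_null_eq' hk2 (i₀ := 1) (j := 0) (l := 2) (by decide) (by decide) (by decide) δ hδ B hB10 hB12 hB01 hB21 hadj hirr Ab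
    (Y₀.map (IsLocalRing.residue (Valued.integer (w.1.adicCompletion L)))) hG hY
  have hc0 : (IsLocalRing.residue (Valued.integer (w.1.adicCompletion L)) (-1))⁻¹ ≠ (0 : Valued.ResidueField (w.1.adicCompletion L)) :=
    inv_ne_zero (by rw [map_neg, map_one]; exact neg_ne_zero.2 one_ne_zero)
  have hclP := two_mul_natCard_params_blockFrame_quadraticChar_eq' hk2 (i₀ := 1) (j := 0) (l := 2) (by decide) (by decide) (by decide) δ hδ B hB10 hB12 hB01 hB21 hadj hirr Ab
    (Y₀.map (IsLocalRing.residue (Valued.integer (w.1.adicCompletion L)))) hG hY _ hc0 (ε := 1) (Or.inl rfl)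
  have hclM := two_mul_natCard_params_blockFrame_quadraticChar_eq' hk2 (i₀ := 1) (j := 0) (l := 2) (by decide) (by decide) (by decide) δ hδ B hB10 hB12 hB01 hB21 hadj hirr Ab
    (Y₀.map (IsLocalRing.residue (Valued.integer (w.1.adicCompletion L)))) hG hY _ hc0 (ε := -1) (Or.inr rfl)
  -- `χ(δ₀δ₂(B₀₂B₂₀ − B₀₀B₂₂)) = −χ(det T̄)`
  have hχW : quadraticChar (Valued.ResidueField (w.1.adicCompletion L)) (δ 0 * δ 2 * (B 0 2 * B 2 0 - (B 0 0 - B 1 1) * (B 2 2 - B 1 1))) =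
      -quadraticChar (Valued.ResidueField (w.1.adicCompletion L)) (IsLocalRing.residue (Valued.integer (w.1.adicCompletion L)) (T 0 0 * T 1 1 - T 0 1 * T 1 0)) := by
    rw [hB11, sub_zero, sub_zero, hB00, hB02, hB20, hB22,
      show δ 0 * δ 2 * (IsLocalRing.residue (Valued.integer (w.1.adicCompletion L)) (T 0 1) * IsLocalRing.residue (Valued.integer (w.1.adicCompletion L)) (T 1 0) - IsLocalRing.residue (Valued.integer (w.1.adicCompletion L)) (T 0 0) * IsLocalRing.residue (Valued.integer (w.1.adicCompletion L)) (T 1 1)) =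
        (-(δ 0 * δ 2)) * IsLocalRing.residue (Valued.integer (w.1.adicCompletion L)) (T 0 0 * T 1 1 - T 0 1 * T 1 0) by rw [map_sub, map_mul, map_mul]; ring,
      map_mul, hχan, neg_one_mul]
  rw [hχW] at hnull hclP hclM
  -- the two sign cases `χ(det T̄) = ±1` and the closing arithmetic
  rw [hqF] at hclP hclM
  have harith := zaniso_zero_odd_A_arith _ _ _ _ _ _ _ _ hqN hnull hclP hclM
  rw [add_assoc, ← add_mul, ← Nat.cast_add] at htot
  refine ⟨_, _, htot, fun hHS1 => harith.1 (hHS.1 hHS1), fun hHSm => harith.2 ?_⟩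
  rcases quadraticChar_dichotomy hdet0 with h | h
  · exact absurd (hHS.2 h) (by rw [hHSm]; decide)
  · exact h

end Literature.NumberTheory.Rogawski1990.BlockLawAniso

end
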